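import Literature.AnabelianGeometry.SemiGraphs.BTempQDPairHomHatGenProofs
import Literature.AnabelianGeometry.SemiGraphs.BTempQDPairRealisationGeneral
import HarnessLib

/-!
# Semi-graphs of anabelioids, Appendix, proof of Theorem A.4: `Hom^ ⥲ Hom_T` for ARBITRARY QD-pairs
# of `B^temp(Π)`, `Π` any topological group

Mochizuki, *Semi-graphs of anabelioids*, Publ. RIMS **42** (2006) 221–322, Appendix, proof of
Theorem A.4, manuscript pp. 84–85 [cite: MochizukiSemiAnbd2006, Thm A.4 proof pp.84-85]: "we thus
obtain a natural bijection between `Hom^((B, Γ_B), (C, Γ_C))` and `Hom_{T_i}(q_i((B, Γ_B)),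
q_i((C, Γ_C)))` … for arbitrary QD-pairs".

PROOF-ONLY follow-up (seat abc-iut-w4-d048, row A4-lim-wc of `plan/L3/SUBDAG-SemiAnbd-Cor311.md`;
no definitions) to abc-iut-w4-d089's `BTempQDPairHomHatGenProofs.lean`: there the surjectivity half
`HomHatGen.toHom_surjective (hG : IsTempered Π)` inherits `IsTempered Π` from the strongly connected
realisation step; `BTempQDPairRealisationGeneral.lean` (`QDPair.homHatToHom_surjective'`) removed that
hypothesis, so — d089's gluing argument verbatim, one hypothesis fewer —

* **`HomHatGen.toHom_surjective'`**, **`toHom_bijective'`**, `existsUnique_toHom_eq'`: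
  `Hom^((B, Γ_B), (C, Γ_C)) ⥲ Hom_T(B/Γ_B, C/Γ_C)` for ARBITRARY QD-pairs and `Π` ANY topological group;
* **`HomHatGen.proj_surjective'`**, **`proj_bijective'`**: for `(B, Γ_B)` weakly connected the
  projections `y ↦ y_b` are bijections, `Π` any topological group.

In [SemiAnbd] `Π` is tempered throughout, so these are harmless generalisations of the printed
statements; the unprimed versions remain the decls of record.  Elementary; nothing refers to the IUT
corpus; no side is taken on any disputed claim.
-/

open CategoryTheory

namespace Literature.AnabelianGeometry.SemiGraphs

open Literature.AlgebraicGeometry.Frobenioids.QuasiTemperoid.BTempConnected (hom_ext_apply)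

universe u

namespace QDPair

namespace HomHatGen

variable {G : Type u} [Group G] [TopologicalSpace G] [IsTopologicalGroup G] {P C : QDPair (BTemp G)}

/-- **`Hom^((B, Γ_B), (C, Γ_C)) → Hom_T(B/Γ_B, C/Γ_C)` is surjective** for arbitrary QD-pairs, `Π` ANY
topological group: realise `q(B′_b → B) ≫ u` on each (strongly connected) component by
`homHatToHom_surjective'` and glue, exactly as in `toHom_surjective`.
[cite: MochizukiSemiAnbd2006, Thm A.4 proof pp.84-85] -/
theorem toHom_surjective' : Function.Surjective (toHom : HomHatGen P C → _) := by
  -- adapted from abc-iut-w4-d089's `toHom_surjective`, with `homHatToHom_surjective'`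
  intro u
  have hex : ∀ b : P.A.obj.V, ∃ x : HomHat (P.componentPair b) C,
      homHatToHom _ C x = orbitQuotientMap (P.componentIncl b) ≫ u := fun b =>
    homHatToHom_surjective' C (P.componentPair_isStronglyConnected b) _
  choose x hx using hex
  refine ⟨⟨x, fun b b' γ hγ h => ?_⟩, ?_⟩
  · apply homHatToHom_injective
    rw [homHatToHom_map_id, hx, hx, ← Category.assoc, orbitQuotientMap_componentIso_inv_incl]
  · apply P.orbitQuotient_hom_ext
    apply hom_ext_apply
    intro z
    change ((toHom ⟨x, _⟩).hom.hom (P.orbitMk z) : C.orbitQuotient.obj.V) = u.hom.hom (P.orbitMk z)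
    rw [toHom_apply]
    change ((homHatToHom _ C (x z)).hom.hom
      ((P.componentPair z).orbitMk (BTemp.orbitPt P.A z)) : C.orbitQuotient.obj.V) = _
    rw [hx]
    rfl

/-- **`Hom^((B, Γ_B), (C, Γ_C)) ⥲ Hom_T(B/Γ_B, C/Γ_C)` for ARBITRARY QD-pairs of `B^temp(Π)`, `Π` ANY
topological group.** [cite: MochizukiSemiAnbd2006, Thm A.4 proof pp.84-85] -/
theorem toHom_bijective' : Function.Bijective (toHom : HomHatGen P C → _) :=
  ⟨toHom_injective, toHom_surjective'⟩

/-- Existence-and-uniqueness form of `toHom_bijective'`. [cite: MochizukiSemiAnbd2006, Thm A.4 proof pp.84-85] -/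
theorem existsUnique_toHom_eq' (u : P.orbitQuotient ⟶ C.orbitQuotient) :
    ∃! y : HomHatGen P C, toHom y = u :=
  (Function.bijective_iff_existsUnique _).mp toHom_bijective' u

/-- **The projection `y ↦ y_b` is surjective** for `(B, Γ_B)` weakly connected, `Π` any topological
group. [cite: MochizukiSemiAnbd2006, Thm A.4 proof p.84] -/
theorem proj_surjective' (hP : P.IsWeaklyConnected) (b : P.A.obj.V) :
    Function.Surjective (fun y : HomHatGen P C => y.proj b) := by
  intro x
  haveI := P.isIso_orbitQuotientMap_componentIncl b hP
  obtain ⟨y, hy⟩ := toHom_surjective' (P := P) (C := C)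
    (inv (orbitQuotientMap (P.componentIncl b)) ≫ homHatToHom _ C x)
  refine ⟨y, homHatToHom_injective _ _ ?_⟩
  change homHatToHom _ C (y.proj b) = homHatToHom _ C x
  rw [← orbitQuotientMap_incl_toHom, hy, IsIso.hom_inv_id_assoc]

/-- **The projections `Hom^((B, Γ_B), (C, Γ_C)) ⥲ Hom^((B′_b, Γ_{B′_b}), (C, Γ_C))` are bijections** for
`(B, Γ_B)` weakly connected, `Π` any topological group ("the natural projections of this direct
product … yield bijections"). [cite: MochizukiSemiAnbd2006, Thm A.4 proof p.84] -/
theorem proj_bijective' (hP : P.IsWeaklyConnected) (b : P.A.obj.V) :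
    Function.Bijective (fun y : HomHatGen P C => y.proj b) :=
  ⟨proj_injective hP b, proj_surjective' hP b⟩

end HomHatGen

end QDPair

end Literature.AnabelianGeometry.SemiGraphs
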